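import Mathlib
import HarnessLib
import Summits.HubbardSuperconductivity.HubbardSuperconductivity.Theorems.KLProgrammeKLRegimeSplitTwoLegFrameLipschitzFn
import Summits.HubbardSuperconductivity.HubbardSuperconductivity.Theorems.KLProgrammeKLRegimeSplitFrameFnMin
import Summits.HubbardSuperconductivity.HubbardSuperconductivity.Theorems.KLProgrammeH10TwoPointLimitFrameFermiPoint

/-!
# Route `KLProgramme` — gen-5 ENGINE child (`KLRegimeEngineV13`; today 19855), stub `stub_twoLeg_step` / `stub_twoLeg_scale0`: the (E3c) clause of the
# (R-I-min) slot (`FrameLipschitzFnT`, BundleV13 p484180) — the two-frame bound of the function pieces AT `K.eval`, keyed by TODAY's frames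

Cell `gate-hubbard-kl`, seat p1b (g6); plan g12 RULING-DRAFT 2026-08-27T01:33:11Z (R1)–(R3): frames stay `K : TrigPolyC4v`, the pieces are p2's
function pieces at `K.eval` (`klTwoLegPieceFn L M β U μ K.eval n`), the comparison distance is today's `frameDist K K′`, and the (E3c) text is
`FrameLipschitzFnT` (`…SplitFrameFnMin` §2).  `…TwoLegFrameLipschitzFn` (p482292) proved the two-frame bound for arbitrary function frames; this file is
the instantiation at `K.eval`, with every side condition DISCHARGED from today's frame hypotheses:

* §1 a `TrigPolyC4v` frame of `C²` size `A` (`‖Dʲ frameShift K‖ ≤ A`, `j ≤ 2`) read as a function: `|K.eval p| ≤ A`, `‖D(onM K.eval)‖ ≤ A`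
  (`abs_eval_le_of_frameShift`, `norm_fderiv_onM_eval_le_of_frameShift`);
* §2 **`abs_klTwoLegPieceFn_eval_succ_sub_le` / `abs_klTwoLegPieceFn_eval_zero_sub_le`**: for frames `K, K′` of `C²` size `A` with `2A < Dt_min` and
  `[μ − A, μ + A] ⊂ [a, b]`: `|ℓ_{n+1}(K.eval)(q) − ℓ_{n+1}(K′.eval)(q)| ≤ (r_{n+1} + r_n) + (b_{n+1} + b_n)·frameDist K K′/(Dt_min − A)` and
  `|ℓ_0(K.eval)(q) − ℓ_0(K′.eval)(q)| ≤ r_0 + frameDist K K′ + (b_0 + A)·frameDist K K′/(Dt_min − A)`, where `r_m` bounds the engine's RESPONSE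
  `|S_m^K(k_F^{K′}θ) − S_m^{K′}(k_F^{K′}θ)|` (`S_m^X = symInterp L (klLocSelfEnergyRe … X m)`, TODAY's data — `klLocSelfEnergyRe_toTrigPoly_eval`) and
  `b_m` the gradient `‖D(evalM S_m^K)‖` (= `coeffNorm 1`, ⇐ the pinned spatial first moment, p485541); the profiles' integrability is discharged by
  `contDiff_klLocalPart` / `contDiff_eval_klFermiPoint` (p4 lineage);
* §3 **`twoLegPiece_lipschitz_of_frameOK_regime`**: keyed by `FrameOK R U (nScales β) μ ·` for BOTH frames in the KL regime (`∃ c₃ U₀ D > 0`, `D = Dt_min/2` of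
  `bandBounds (−1.1) (−0.1)`), in the binder shape of the engine skeleton — what `FrameLipschitzFnT … K (n+1)` then costs the stub prover is the response
  numbers `r ≤ ρ·frameDist K K′` and the fit `(ρ_{n+1} + ρ_n) + (b_{n+1} + b_n)/D ≤ lipBar (n+1)`.

Everything is PROVED; no definitions; nothing about the model is asserted.  References: BGM 2006 §2.4 Lemma 2.1 [cite: BenfattoGiulianiMastropietro2006];
FST IV §1 (the reading point moves with the frame).
-/

noncomputable section

namespace Summit.HubbardSuperconductivity.HubbardSuperconductivity.Theorems.KLRegimeSplit

set_option linter.dupNamespace false -- summit = problem name (single-conjunct summit), D-0017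

open Real Set MeasureTheory
open Literature.MathematicalPhysics.QuantumLattice Literature.MathematicalPhysics.QuantumLattice.BandSectorCounting
open Literature.Probability.LatticeModels
open Summit.HubbardSuperconductivity.HubbardSuperconductivity.Theorems.DispersionFlow
open Summit.HubbardSuperconductivity.HubbardSuperconductivity.Theorems.PerturbedFermiCurve
open Summit.HubbardSuperconductivity.HubbardSuperconductivity.Theorems.KLProgrammeLegKernels

/-! ## §1 A `TrigPolyC4v` frame of `C²` size `A` read as a function -/

/-- `|K.eval p| ≤ A` from the order-`0` bound on `frameShift K`. -/
theorem abs_eval_le_of_frameShift {K : TrigPolyC4v} {A : ℝ} (hA : ∀ p : Momentum, ∀ j ≤ 2, ‖iteratedFDeriv ℝ j (frameShift K) p‖ ≤ A)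
    (p : Fin 2 → ℝ) : |K.eval p| ≤ A := by
  have h := abs_frameShift_toLp_le hA p
  rwa [frameShift_toLp, abs_neg] at h

/-- `‖D(onM K.eval)(q)‖ ≤ A` from the order-`1` bound on `frameShift K` (`onM K.eval = evalM K = −frameShift K`). -/
theorem norm_fderiv_onM_eval_le_of_frameShift {K : TrigPolyC4v} {A : ℝ}
    (hA : ∀ p : Momentum, ∀ j ≤ 2, ‖iteratedFDeriv ℝ j (frameShift K) p‖ ≤ A) (q : Momentum) :
    ‖fderiv ℝ (onM K.eval) q‖ ≤ A := by
  have hfun : onM K.eval = -frameShift K := by funext q; simp [onM, frameShift]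
  rw [hfun, ← norm_iteratedFDeriv_one, iteratedFDeriv_neg_apply, norm_neg]
  exact hA q 1 (by norm_num)

/-! ## §2 The two-frame bound of the function pieces at `K.eval` -/

section TwoFrames

variable {L M : ℕ} [NeZero L] [NeZero M]
variable {a b : ℝ} (B : BandBounds a b) {K K' : TrigPolyC4v} {A : ℝ}
  (hA : ∀ p : Momentum, ∀ j ≤ 2, ‖iteratedFDeriv ℝ j (frameShift K) p‖ ≤ A)
  (hA' : ∀ p : Momentum, ∀ j ≤ 2, ‖iteratedFDeriv ℝ j (frameShift K') p‖ ≤ A)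
  (hADt : 2 * A < B.Dtmin) {μ : ℝ} (hlo : a ≤ μ - A) (hhi : μ + A ≤ b)
include B hA hA' hADt hlo hhi

/-- **(E3c), (R-I-min) slot, scale `n + 1`**: with `S_m^X = symInterp L (klLocSelfEnergyRe L M β U μ X m)`, gradient bounds `‖D(evalM S_m^K)‖ ≤ b_m`
(`b_m ≥ 0`) and response bounds `|S_m^K(k_F^{K′}θ) − S_m^{K′}(k_F^{K′}θ)| ≤ r_m` (`m = n, n + 1`), for two frames of `C²` size `A`:
`|klTwoLegPieceFn … K.eval (n+1) q − klTwoLegPieceFn … K′.eval (n+1) q| ≤ (r_{n+1} + r_n) + (b_{n+1} + b_n)·frameDist K K′/(Dt_min − A)`. -/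
theorem abs_klTwoLegPieceFn_eval_succ_sub_le {β U : ℝ} {n : ℕ} {b₁ b₀ r₁ r₀ : ℝ} (hb₁ : 0 ≤ b₁) (hb₀ : 0 ≤ b₀)
    (hgrad₁ : ∀ q : Momentum, ‖fderiv ℝ (evalM (symInterp L (klLocSelfEnergyRe L M β U μ K (n + 1)))) q‖ ≤ b₁)
    (hgrad₀ : ∀ q : Momentum, ‖fderiv ℝ (evalM (symInterp L (klLocSelfEnergyRe L M β U μ K n))) q‖ ≤ b₀)
    (hresp₁ : ∀ θ : ℝ, |(symInterp L (klLocSelfEnergyRe L M β U μ K (n + 1))).eval (klFermiPoint μ K' θ) -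
      (symInterp L (klLocSelfEnergyRe L M β U μ K' (n + 1))).eval (klFermiPoint μ K' θ)| ≤ r₁)
    (hresp₀ : ∀ θ : ℝ, |(symInterp L (klLocSelfEnergyRe L M β U μ K n)).eval (klFermiPoint μ K' θ) -
      (symInterp L (klLocSelfEnergyRe L M β U μ K' n)).eval (klFermiPoint μ K' θ)| ≤ r₀) (q : Fin 2 → ℝ) :
    |klTwoLegPieceFn L M β U μ K.eval (n + 1) q - klTwoLegPieceFn L M β U μ K'.eval (n + 1) q| ≤
      (r₁ + r₀) + (b₁ + b₀) * (frameDist K K' / (B.Dtmin - A)) := by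
  have hA0 : 0 ≤ A := le_trans (norm_nonneg _) (hA 0 0 (by norm_num))
  have hA1 : A < B.Dtmin := by linarith
  have hI : ∀ (X : TrigPolyC4v) (hX : ∀ p : Momentum, ∀ j ≤ 2, ‖iteratedFDeriv ℝ j (frameShift X) p‖ ≤ A) (m : ℕ),
      IntervalIntegrable (klLocalPartFn L M β U μ X.eval m) volume 0 (2 * π) := fun X hX m => by
    rw [klLocalPartFn_eval]
    exact ((contDiff_klLocalPart B hX hADt hlo hhi L M β U m (m := 0)).continuous).intervalIntegrable _ _
  have h := abs_klTwoLegPieceFn_succ_sub_le B (isSymmetricFrame_eval K) (isSymmetricFrame_eval K') (differentiable_evalM K)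
    (differentiable_evalM K') (abs_eval_le_of_frameShift hA) (abs_eval_le_of_frameShift hA') (norm_fderiv_onM_eval_le_of_frameShift hA)
    hA1 hlo hhi (L := L) (M := M) (β := β) (U := U) (n := n) hb₁ hb₀
    (by simpa only [klLocSelfEnergyRe_toTrigPoly_eval] using hgrad₁)
    (by simpa only [klLocSelfEnergyRe_toTrigPoly_eval] using hgrad₀)
    (by simpa only [klLocSelfEnergyRe_toTrigPoly_eval, klFermiPointFn_eval] using hresp₁)
    (by simpa only [klLocSelfEnergyRe_toTrigPoly_eval, klFermiPointFn_eval] using hresp₀)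
    (hI K hA (n + 1)) (hI K' hA' (n + 1)) (hI K hA n) (hI K' hA' n) q
  rwa [frameDistFn_eval] at h

/-- **(E3c), (R-I-min) slot, scale `0`** (the normal-form half needs no engine input):
`|klTwoLegPieceFn … K.eval 0 q − klTwoLegPieceFn … K′.eval 0 q| ≤ r_0 + frameDist K K′ + (b_0 + A)·frameDist K K′/(Dt_min − A)`. -/
theorem abs_klTwoLegPieceFn_eval_zero_sub_le {β U : ℝ} {b₀ r₀ : ℝ} (hb₀ : 0 ≤ b₀)
    (hgrad₀ : ∀ q : Momentum, ‖fderiv ℝ (evalM (symInterp L (klLocSelfEnergyRe L M β U μ K 0))) q‖ ≤ b₀)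
    (hresp₀ : ∀ θ : ℝ, |(symInterp L (klLocSelfEnergyRe L M β U μ K 0)).eval (klFermiPoint μ K' θ) -
      (symInterp L (klLocSelfEnergyRe L M β U μ K' 0)).eval (klFermiPoint μ K' θ)| ≤ r₀) (q : Fin 2 → ℝ) :
    |klTwoLegPieceFn L M β U μ K.eval 0 q - klTwoLegPieceFn L M β U μ K'.eval 0 q| ≤
      r₀ + frameDist K K' + (b₀ + A) * (frameDist K K' / (B.Dtmin - A)) := by
  have hA0 : 0 ≤ A := le_trans (norm_nonneg _) (hA 0 0 (by norm_num))
  have hA1 : A < B.Dtmin := by linarith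
  have hI0 : ∀ (X : TrigPolyC4v) (hX : ∀ p : Momentum, ∀ j ≤ 2, ‖iteratedFDeriv ℝ j (frameShift X) p‖ ≤ A),
      IntervalIntegrable (klLocalPartFn L M β U μ X.eval 0) volume 0 (2 * π) := fun X hX => by
    rw [klLocalPartFn_eval]
    exact ((contDiff_klLocalPart B hX hADt hlo hhi L M β U 0 (m := 0)).continuous).intervalIntegrable _ _
  have hIK : ∀ (X : TrigPolyC4v) (hX : ∀ p : Momentum, ∀ j ≤ 2, ‖iteratedFDeriv ℝ j (frameShift X) p‖ ≤ A),
      IntervalIntegrable (fun θ => X.eval (klFermiPointFn μ X.eval θ)) volume 0 (2 * π) := fun X hX => by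
    rw [klFermiPointFn_eval]
    exact ((contDiff_eval_klFermiPoint B hX hADt hlo hhi X (m := 0)).continuous).intervalIntegrable _ _
  have h := abs_klTwoLegPieceFn_zero_sub_le B (isSymmetricFrame_eval K) (isSymmetricFrame_eval K') (differentiable_evalM K)
    (differentiable_evalM K') (abs_eval_le_of_frameShift hA) (abs_eval_le_of_frameShift hA') (norm_fderiv_onM_eval_le_of_frameShift hA)
    hA1 hlo hhi (L := L) (M := M) (β := β) (U := U) hb₀
    (by simpa only [klLocSelfEnergyRe_toTrigPoly_eval] using hgrad₀)
    (by simpa only [klLocSelfEnergyRe_toTrigPoly_eval, klFermiPointFn_eval] using hresp₀)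
    (hI0 K hA) (hI0 K' hA') (hIK K hA) (hIK K' hA') q
  rwa [frameDistFn_eval] at h

end TwoFrames

/-! ## §3 Keyed by `FrameOK` in the KL regime -/

section Model

variable {L M : ℕ} [NeZero L] [NeZero M]

/-- **(E3c) TWO-FRAME BOUND FOR EVERY PAIR OF ADMISSIBLE FRAMES IN THE KL REGIME (scale `n + 1`).**  For every `R` (`Gfr ≥ 0`) there are
`c₃, U₀, D > 0` such that, for `0 < c ≤ c₃`, `0 < U ≤ U₀`, `klBetaMin ≤ β ≤ e^{c/U²}`, `μ ∈ klWindowC`, frames `K, K′` with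
`FrameOK R U (nScales β) μ ·`, all volumes and scales, gradient bounds `b_{n+1}, b_n ≥ 0` on `evalM S^K_{n+1}, evalM S^K_n` and response bounds
`r_{n+1}, r_n` at `K′`'s reading points:
`|klTwoLegPieceFn … K.eval (n+1) q − klTwoLegPieceFn … K′.eval (n+1) q| ≤ (r_{n+1} + r_n) + (b_{n+1} + b_n)·frameDist K K′/D`.
(`D = Dt_min/2` of `bandBounds (−1.1) (−0.1)`.) [cite: BenfattoGiulianiMastropietro2006, §2.4 Lemma 2.1] -/
theorem twoLegPiece_lipschitz_of_frameOK_regime (R : RenConsts) (hR : ∀ j, 0 ≤ R.Gfr j) :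
    ∃ c₃ : ℝ, 0 < c₃ ∧ ∃ U₀ : ℝ, 0 < U₀ ∧ ∃ D : ℝ, 0 < D ∧
      ∀ c : ℝ, 0 < c → c ≤ c₃ → ∀ U : ℝ, 0 < U → U ≤ U₀ → ∀ β : ℝ, klBetaMin ≤ β → β ≤ Real.exp (c / U ^ 2) →
      ∀ μ ∈ klWindowC, ∀ K K' : TrigPolyC4v, FrameOK R U (nScales β) μ K → FrameOK R U (nScales β) μ K' →
        ∀ (L M : ℕ) [NeZero L] [NeZero M] (n : ℕ) (b₁ b₀ r₁ r₀ : ℝ), 0 ≤ b₁ → 0 ≤ b₀ →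
          (∀ q : Momentum, ‖fderiv ℝ (evalM (symInterp L (klLocSelfEnergyRe L M β U μ K (n + 1)))) q‖ ≤ b₁) →
          (∀ q : Momentum, ‖fderiv ℝ (evalM (symInterp L (klLocSelfEnergyRe L M β U μ K n))) q‖ ≤ b₀) →
          (∀ θ : ℝ, |(symInterp L (klLocSelfEnergyRe L M β U μ K (n + 1))).eval (klFermiPoint μ K' θ) -
            (symInterp L (klLocSelfEnergyRe L M β U μ K' (n + 1))).eval (klFermiPoint μ K' θ)| ≤ r₁) →
          (∀ θ : ℝ, |(symInterp L (klLocSelfEnergyRe L M β U μ K n)).eval (klFermiPoint μ K' θ) -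
            (symInterp L (klLocSelfEnergyRe L M β U μ K' n)).eval (klFermiPoint μ K' θ)| ≤ r₀) →
          ∀ q : Fin 2 → ℝ,
            |klTwoLegPieceFn L M β U μ K.eval (n + 1) q - klTwoLegPieceFn L M β U μ K'.eval (n + 1) q| ≤
              (r₁ + r₀) + (b₁ + b₀) * (frameDist K K' / D) := by
  have ha : (-4 : ℝ) < -1.1 := by norm_num
  have hab : (-1.1 : ℝ) ≤ -0.1 := by norm_num
  have hb : (-0.1 : ℝ) < 0 := by norm_num
  set B := bandBounds ha hab hb with hBdef
  have hDt := B.Dtmin_pos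
  set κ : ℝ := min B.Dtmin (1 / 5) with hκdef
  have hκ : 0 < κ := lt_min hDt (by norm_num)
  obtain ⟨c₃, hc₃, U₀, hU₀, hthr⟩ := frame_thresholds hR hκ
  refine ⟨c₃, hc₃, U₀, hU₀, B.Dtmin / 2, by positivity, ?_⟩
  intro c hc hcle U hU hUle β hβmin hβc μ hμ K K' hK hK' L M _ _ n b₁ b₀ r₁ r₀ hb₁ hb₀ hgrad₁ hgrad₀ hresp₁ hresp₀ q
  have hAf : ∀ p : Momentum, ∀ j ≤ 2, ‖iteratedFDeriv ℝ j (frameShift K) p‖ ≤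
      2 * R.Gfr 0 * |U| + 2 * R.Gfr 1 * U ^ 2 + R.Gfr 2 * (c / Real.log 4) := fun p j hj =>
    norm_iteratedFDeriv_frameShift_le_of_frameOK_regime hR hc.le hβmin hβc hK p hj
  have hAf' : ∀ p : Momentum, ∀ j ≤ 2, ‖iteratedFDeriv ℝ j (frameShift K') p‖ ≤
      2 * R.Gfr 0 * |U| + 2 * R.Gfr 1 * U ^ 2 + R.Gfr 2 * (c / Real.log 4) := fun p j hj =>
    norm_iteratedFDeriv_frameShift_le_of_frameOK_regime hR hc.le hβmin hβc hK' p hj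
  set A := 2 * R.Gfr 0 * |U| + 2 * R.Gfr 1 * U ^ 2 + R.Gfr 2 * (c / Real.log 4) with hAdef
  have h4A : 4 * A ≤ κ := hthr c U hc.le hcle hU hUle
  have hA0 : 0 ≤ A := le_trans (norm_nonneg _) (hAf 0 0 (by norm_num))
  have hκDt : κ ≤ B.Dtmin := min_le_left _ _
  have hκ5 : κ ≤ 1 / 5 := min_le_right _ _
  have hADt : 2 * A < B.Dtmin := by linarith
  have hA20 : A ≤ 1 / 20 := by linarith
  obtain ⟨hlo, hhi⟩ := klWindowC_margin hμ hA20
  have h := abs_klTwoLegPieceFn_eval_succ_sub_le B hAf hAf' hADt hlo hhi hb₁ hb₀ hgrad₁ hgrad₀ hresp₁ hresp₀ q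
  -- `frameDist/(Dt − A) ≤ frameDist/(Dt/2)`
  have hfd : 0 ≤ frameDist K K' := frameDist_nonneg K K'
  have hden : frameDist K K' / (B.Dtmin - A) ≤ frameDist K K' / (B.Dtmin / 2) :=
    div_le_div_of_nonneg_left hfd (by positivity) (by linarith)
  have hb : 0 ≤ b₁ + b₀ := by positivity
  exact h.trans (by nlinarith [mul_le_mul_of_nonneg_left hden hb])

end Model

end Summit.HubbardSuperconductivity.HubbardSuperconductivity.Theorems.KLRegimeSplit

end
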